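import Literature.MathematicalPhysics.QuantumFieldTheory.Balaban1983to89.B3Ineq210ConstBox
import Literature.MathematicalPhysics.QuantumFieldTheory.Balaban1983to89.B3Ineq25ZeroNest

/-!
# `Balaban1983to89.B3Ineq25ConstNest` — T. Bałaban, *(Higgs)₂,₃ quantum fields in a finite volume. III. Renormalization*,
# Commun. Math. Phys. **88** (1983) 411–445 [Balaban1983Higgs3]: the localization estimate (2.5) p. 424, `δG_k(Ω,Ω₂,B̃)` alternative,
# `‖hδG_k(Ω,Ω₂,B̃)h′‖_{1,α} ≤ O(e^{−δ₀dist(Ω₂,∂Ω)})e^{−δ₀dist(supp h,supp h′)}` PROVED for the MODEL INSTANCE of NESTED BOXES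
# `Ω₂ = □ ⊂ Ω = □₀`, `B̃ = B̃₀` a NON-ZERO CONSTANT background, `N` colours, unit-cube localizations — `ScaledKernels.Ineq25 α δ₀ C`
# DISCHARGED, uniformly in `B̃₀`, for the carrier `sect2DeltaConstNest` whose many-variable (1.32) norm carries the COVARIANT
# derivatives `D^η_{B̃₀}` in both variables and the TRANSPORTS `U(B̃₀(Γ))` on both sides — by the p. 433 gauge step on top of
# this seat's zero-field instance `B3Ineq25ZeroNest` (gen 6)

statement-level skeleton of published theorems with citation tags; proofs where landed; nothing here is a claim about the Yang–Mills mass gap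

PDF held: `paper:balaban1983-higgs-2-3-quantum-fields-finite-volume` (journal page = PDF page + 410); p. 420 [PDF 10] ((1.32)),
p. 424 [PDF 14] ((2.5)), p. 433 [PDF 23] (the gauge transformation removing `B̃₀`), p. 434 [PDF 24] (the norms sentence) read in
the OCR text (`p0010.txt`, `p0014.txt`, `p0023.txt`, `p0024.txt`).

CITATION HEADER (lean-in-tree rule).  Part of the lit-balaban TYPED SKELETON (HOME `run/shared/lean/pub/lit-balaban/`), Phase 2,
proof seat **p03 gen 7** (unit `lit-balaban-p03-g7`); SKELETON row **B3.Eq2.5** (fold owner r15, `HOME/lit-balaban-r15/ROWS-B3.md`;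
decl of record `B3Sect2StatementsPart2.ScaledKernels.Ineq25`).  CONSTANT-BACKGROUND TWIN of this seat's zero-field nested-box
instance `B3Ineq25ZeroNest` (gen 6, p300881: `CubeMargin`, `kerD`/`derivD`/`normHGH`, `sect2DeltaZeroNest`, `ineq25_zeroNest`
over the six kernel clauses of `B3DeltaGkZeroNest` p300118 — all USED BY NAME) over this generation's `B3Eq26ConstBox` (p304272:
the gauge `gA0`, the covariant propagator `GfineA0 … k`, `blk2_GfineA0`, the transporter `Ub`) and `B3Ineq210ConstBox` (p304653:
`entrySup`, the constant-background carrier `constBoxKernels` whose (2.10)/(2.11) fields are copied); gen 4's index sets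
`B3Ineq31ZeroBox.sites`/`bonds`/`dirOf`/`baseOf`/`pdist`/`cubeDist` (p256797); nothing re-proved, no existing module touched.

WHAT IS PRINTED.  p. 424: *"In the estimates we treat them as external fields and we localize them … ‖h(an operator δG_k(Ω,Ω₂,B̃)
or (1.16))h′‖_{1,α} ≤ O(e^{−δ₀dist(Ω₂,∂Ω)} or (e(L^kε)p(L^kε))^{n+n′})e^{−δ₀dist(supp h, supp h′)}, (2.5) where h, h′ are functions
giving the localizations of the vertices."*  p. 433/434: *"Our next operation is the gauge transformation which removes the field
B̃₀. … We get the same expressions as above with B̃₀ = 0 only (and external scalar fields gauge transformed). … these norms are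
equal to the norms defined by (1.32) with B̃ = B̃₀."*

WHAT IS REPRODUCED (kind «model-instance», G.1 of `HOME/PHASE2-TARGETS.md`), in the setting of `B3Eq26ConstBox` (fine boxes
`⊂ ηℤ^{d+1}`, `η = L^{−k}`, `N` colours `ℝ^N = ι → ℝ`, orthogonal flow `F`, `κ = eη`, constant `B̃₀`, gauge `g = U(κλ)`, `λ = −⟨B̃₀,x⟩`):
* §2 **`gA0_pair_emb`**: the gauges of the outer box `Ω` and of the inner box `Ω₂` (the same linear `λ` in coordinates differing by
  the constant shift) give THE SAME transporters `g(x)g(x′)ᵀ` — the constant field on `Ω₂` is the restriction of the one on `Ω`;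
  **`dGkA0`** = the blocks of `δG_k(Ω,Ω₂,B̃₀) = G_k(Ω,B̃₀) − G_k(Ω₂,B̃₀)` (both covariant propagators `GfineA0 … k`), and **`dGkA0_eq`**:
  they are the zero-field kernel `B3DeltaGkZeroNest.dGk` times the transporter;
* §3 the many-variable (1.32) DATA on `□(v) × □(v′)`: values `kerDA` (blocks read as functions `ι → ι → ℝ`, sup norm over entries),
  covariant derivatives `derivDA` in all `2(d+1)` directions (row bonds `U(B̃₀,⟨x,xe⟩)F(xe,x′) − F(x,x′)`, column bonds
  `F(x,x′e)U(B̃₀,⟨x′,x′e⟩)ᵀ − F(x,x′)`), two-sided transports `tauDA`, the norm **`normHGHA`** = r15's `norm132`;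
* §4 **the carrier `sect2DeltaConstNest : ScaledKernels`** extending `constBoxKernels` (`ineq25_iff`, `ineq210_iff_constBox`,
  `ineq211At_iff_constBox` all `Iff.rfl` — so (2.10)/(2.11) for this carrier are `ineq210_constBox`/`ineq211At_constBox`);
* §5 «the same expressions with B̃₀ = 0»: `kerDA_eq`, `derivDA_eq`, `tauDA_derivDA_eq`; hence **`normHGHA_le`**:
  `‖hδG_k(Ω,Ω₂,B̃₀)h′‖_{1,α} ≤ ‖hδG_k(Ω,Ω₂,0)h′‖_{1,α}`;
* §6 **`ineq25_constNest`**: for every `0 ≤ α < 1`, `∃ δ₀ C > 0` (on `d + 1`, `L`, the window, `α`; NOT on `B̃₀`, `κ`, the flow)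
  `∀ k ≥ 1 ∀ window ∀ nested boxes ∀ r₀ ≥ 3 ∀ B̃₀`, `(sect2DeltaConstNest …).Ineq25 α δ₀ C`; witness `ineq25_constNest_witness`.

HONEST SCOPE / DECLARED DIVERGENCES (F7).  (i) NESTED BOXES `Ω₂ = □ ⊂ Ω = □₀` in `ηℤ^{d+1}` (not the torus: the linear gauge is not
periodic), `B̃ = B̃₀` CONSTANT (the print's general small `B̃` needs the p. 433 `B̃′`-expansion / [B4] (2.23)–(2.33), not formalised),
unit-cube (indicator) localizations of cube margin `r₀ ≥ 3`, `distΩ₂ := r₀` — gen 6's declared reading (i) and G-B3-14 apply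
verbatim.  (ii) The (1.16) alternative of (2.5) is not modelled (`norm116 := 0`, second conjunct trivial); (2.12) not modelled
(`absGavg := 0`); `eRun := pRun := 0`.  (iii) Block values read as functions `ι → ι → ℝ` with the sup norm over entries; for the
blocks `c·U`, `U` orthogonal, met here this is `≤ |c|`, so the domination holds under either reading of `|·|` on `End(ℝ^N)`.
(iv) Abelian one-parameter orthogonal structure group.  (v) «extends in a natural way to functions of many variables» READ as in
gens 4/6 WITH the natural covariant structure (left transport in the first variable, transposed transport in the second), as in
`B3Ineq31ConstBox`.  (vi) `∀ α ∈ [0,1) ∃ (δ₀, C)`, existential constants.  (vii) ROUTE = the print's (gauge step p. 433 + the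
zero-field instance); no Literature fact minted (defs with bodies, theorems proved); standard axioms.  Value = kernel certificate
that (2.5) at a constant background on nested boxes IS the zero-field (2.5) dressed with orthogonal transporters; NOT summit progress.
Unit `lit-balaban-p03-g7` (Phase-2 proof seat p03, gen 7); HOME `run/shared/lean/pub/lit-balaban/` (row B3.Eq2.5; FILED.md, STATUS.md).
-/

namespace Literature.MathematicalPhysics.QuantumFieldTheory.Balaban1983to89.B3Ineq25ConstNest

open Matrix Finset
open scoped Kronecker NNReal
open B4GaugeCovariance
open B4Reflection242 (boxDom mem_boxDom)
open B4ContourShift (supNorm)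
open B4TwoBox120 (Fits emb emb_val)
open B4Thm110ZeroBox (Nf Gfine one_lt_L_real)
open B3Sect2StatementsPart2
open B3Sect1Statements (norm132)
open LatticeNorms (supNorm holderSeminorm)
open B3Ineq31ZeroBox (cubeDist sites bonds dirOf baseOf pdist)
open B3DeltaGkZeroNest (dGk)
open B3Ineq25ZeroNest (CubeMargin normHGH sect2DeltaZeroNest ineq25_zeroNest)
open B3Eq26ConstBox B3Ineq210ConstBox

noncomputable section

variable {d : ℕ} {ι : Type} [Fintype ι] [DecidableEq ι]

/-! ## §1 Monotonicity of the (1.32) ingredients and the size of a block `t·O` (kernel helpers) -/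

section Mono

variable {X κ' E₁ E₂ : Type*} [SeminormedAddCommGroup E₁] [SeminormedAddCommGroup E₂]

omit [Fintype ι] [DecidableEq ι] in
/-- kernel: the sup part of (1.32) is monotone in the sitewise norms. [folklore] -/
private theorem supNorm_mono {S : Finset X} {f : X → E₁} {f' : X → E₂} (h : ∀ x, ‖f x‖ ≤ ‖f' x‖) :
    LatticeNorms.supNorm S f ≤ LatticeNorms.supNorm S f' := by
  unfold LatticeNorms.supNorm
  exact NNReal.coe_le_coe.mpr (Finset.sup_mono_fun fun x _ => by
    have := h x
    exact NNReal.coe_le_coe.mp (by simpa using this))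

omit [Fintype ι] [DecidableEq ι] in
/-- kernel: the Hölder part of (1.32) is monotone in the norms of the transported differences. [folklore] -/
private theorem holderSeminorm_mono {α : ℝ} {adm : κ' → κ' → Prop} {dist : κ' → κ' → ℝ} {τ : κ' → κ' → E₁ → E₁}
    {τ' : κ' → κ' → E₂ → E₂} {S : Finset κ'} {f : κ' → E₁} {f' : κ' → E₂}
    (h : ∀ p q, ‖τ p q (f q) - f p‖ ≤ ‖τ' p q (f' q) - f' p‖) :
    holderSeminorm α adm dist τ S f ≤ holderSeminorm α adm dist τ' S f' := by
  unfold LatticeNorms.holderSeminorm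
  refine NNReal.coe_le_coe.mpr (Finset.sup_mono_fun fun p _ => ?_)
  have h1 : ‖τ p.1 p.2 (f p.2) - f p.1‖₊ ≤ ‖τ' p.1 p.2 (f' p.2) - f' p.1‖₊ :=
    NNReal.coe_le_coe.mp (by simpa using h p.1 p.2)
  simpa only [div_eq_mul_inv] using mul_le_mul_of_nonneg_right h1 (bot_le : (0 : ℝ≥0) ≤ ((dist p.1 p.2 ^ α).toNNReal)⁻¹)

/-- kernel: a block `t·O` with `O` orthogonal, read as a function `ι → ι → ℝ` with the sup norm, has norm `≤ |t|`. [folklore] -/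
private theorem pi_norm_smul_orth_le {O : Matrix ι ι ℝ} (hO : Oᵀ * O = 1) (t : ℝ) :
    ‖(fun i i' => t * O i i' : ι → ι → ℝ)‖ ≤ |t| := by
  refine (pi_norm_le_iff_of_nonneg (abs_nonneg t)).2 fun i => (pi_norm_le_iff_of_nonneg (abs_nonneg t)).2 fun i' => ?_
  rw [Real.norm_eq_abs, abs_mul]
  exact mul_le_of_le_one_right (abs_nonneg t) (abs_apply_le_one_of_orthogonal hO i i')

/-- kernel: `g(x)g(y)ᵀ · g(y)g(z)ᵀ = g(x)g(z)ᵀ`. [folklore] -/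
private theorem pair_mul_pair {g : X → Matrix ι ι ℝ} (hg : IsGauge g) (x y z : X) :
    g x * (g y)ᵀ * (g y * (g z)ᵀ) = g x * (g z)ᵀ := by
  rw [Matrix.mul_assoc, ← Matrix.mul_assoc (g y)ᵀ (g y), hg y, Matrix.one_mul]

end Mono

/-! ## §2 The outer and inner gauges agree on transporters; the blocks of `δG_k(Ω,Ω₂,B̃₀)` -/

section Delta

variable {F : OrthFlow ι} {κ : ℝ} {A₀ : Fin (d + 1) → ℝ} {ℓ k : ℕ} {M M0 : Fin (d + 1) → ℕ} {s : Fin (d + 1) → ℤ}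
  {a m2 : ℝ}

/-- kernel: `U(a)U(b)ᵀ = U(a − b)` for the flow. [folklore] -/
private theorem U_mul_transpose (F : OrthFlow ι) (a b : ℝ) : F.U a * (F.U b)ᵀ = F.U (a - b) := by
  rw [F.transpose_eq, ← F.map_add, sub_eq_add_neg]

/-- **the transporters of the outer box restrict to those of the inner box**: for the gauge `g₀` of `Ω = □₀` and `g` of `Ω₂ = □`
(the same linear `λ = −⟨B̃₀,·⟩` in outer resp. inner coordinates, which differ by the constant shift `⟨B̃₀, ns⟩`),
`g₀(x+ns)g₀(x′+ns)ᵀ = g(x)g(x′)ᵀ` — the constant field on `Ω₂` IS the restriction of the one on `Ω`. [cite: Balaban1983Higgs3, (2.5) p.424] -/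
theorem gA0_pair_emb (hs : Fits M M0 s) (x x' : ↥(boxDom (Nf ℓ k M))) :
    gA0 F κ A₀ ℓ k M0 (emb (hs.scale ((ℓ + 1) ^ k)) x) * (gA0 F κ A₀ ℓ k M0 (emb (hs.scale ((ℓ + 1) ^ k)) x'))ᵀ
      = gA0 F κ A₀ ℓ k M x * (gA0 F κ A₀ ℓ k M x')ᵀ := by
  simp only [gA0, U_mul_transpose]
  congr 1
  simp only [linGauge, emb_val, Pi.add_apply, Int.cast_add, Int.cast_mul, Int.cast_natCast, mul_add, Finset.sum_add_distrib]
  ring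

variable (F κ A₀) in
/-- **`δG_k(Ω,Ω₂,B̃₀) = G_k(Ω,B̃₀) − G_k(Ω₂,B̃₀)` at the constant background for the nested boxes `Ω₂ = □ ⊂ Ω = □₀`**, as `N × N` blocks
on the fine points of `Ω₂` (outer kernel at the translated points): the covariant propagators `B3Eq26ConstBox.GfineA0 … k` of the two
boxes ([B4] (1.6) at `B̃₀`). [cite: Balaban1983Higgs3, (2.5) p.424] -/
def dGkA0 (ℓ k : ℕ) (hs : Fits M M0 s) (a m2 : ℝ) (x x' : ↥(boxDom (Nf ℓ k M))) : Matrix ι ι ℝ :=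
  blk2 (GfineA0 F κ A₀ ℓ k M0 k a m2) (emb (hs.scale ((ℓ + 1) ^ k)) x) (emb (hs.scale ((ℓ + 1) ^ k)) x')
    - blk2 (GfineA0 F κ A₀ ℓ k M k a m2) x x'

/-- **the blocks of `δG_k(Ω,Ω₂,B̃₀)` are the zero-field kernel `δG_k(Ω,Ω₂,0)` (`B3DeltaGkZeroNest.dGk`) times the transporter
`g(x)g(x′)ᵀ`** — p. 433 «the same expressions as above with B̃₀ = 0 only». [cite: Balaban1983Higgs3, p.433] -/
theorem dGkA0_eq (hℓ : 1 ≤ ℓ) (hk : 1 ≤ k) (hs : Fits M M0 s) (hM : ∀ i, 1 ≤ M i) (hM0 : ∀ i, 1 ≤ M0 i) (ha : 0 < a)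
    (hm : 0 ≤ m2) (x x' : ↥(boxDom (Nf ℓ k M))) :
    dGkA0 F κ A₀ ℓ k hs a m2 x x' = dGk ℓ k hs a m2 x x' • (gA0 F κ A₀ ℓ k M x * (gA0 F κ A₀ ℓ k M x')ᵀ) := by
  rw [dGkA0, blk2_GfineA0 hℓ hk le_rfl hM0 ha hm, blk2_GfineA0 hℓ hk le_rfl hM ha hm, gA0_pair_emb hs, dGk, sub_smul]

end Delta

/-! ## §3 The two-variable (1.32) data of `δG_k(Ω,Ω₂,B̃₀)` on `□(v) × □(v′)` with covariant derivatives and two-sided transports -/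

section Data

variable (F : OrthFlow ι) (κ : ℝ) (A₀ : Fin (d + 1) → ℝ) (ℓ k : ℕ) {M M0 : Fin (d + 1) → ℕ} {s : Fin (d + 1) → ℤ}
  (hs : Fits M M0 s) (a m2 : ℝ)

/-- the two-variable field of (2.5): `F(x,x′) = η^{−(d+1)}δG_k(Ω,Ω₂,B̃₀;x,x′)`, an `N × N` block read as a function `ι → ι → ℝ`.
[cite: Balaban1983Higgs3, (2.5) p.424] -/
def kerDA (z : ↥(boxDom (Nf ℓ k M)) × ↥(boxDom (Nf ℓ k M))) : ι → ι → ℝ :=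
  fun i i' => ((((ℓ + 1) ^ k : ℕ)) : ℝ) ^ (d + 1) * dGkA0 F κ A₀ ℓ k hs a m2 z.1 z.2 i i'

/-- the covariant derivatives of the two-variable field in all `2(d+1)` directions ([B4] (1.3); row bonds:
`η^{−1}(U(B̃₀,⟨x,xe⟩)F(xe,x′) − F(x,x′))`, column bonds: `η^{−1}(F(x,x′e)U(B̃₀,⟨x′,x′e⟩)ᵀ − F(x,x′))`; the link variables of `Ω₂`, which
are those of `Ω` restricted). [cite: Balaban1983Higgs3, (1.32) p.420] -/
def derivDA : ((Fin (d + 1) × ((↥(boxDom (Nf ℓ k M)) × ↥(boxDom (Nf ℓ k M))) × ↥(boxDom (Nf ℓ k M)))) ⊕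
      (Fin (d + 1) × ((↥(boxDom (Nf ℓ k M)) × ↥(boxDom (Nf ℓ k M))) × ↥(boxDom (Nf ℓ k M))))) → (ι → ι → ℝ) :=
  Sum.elim
    (fun b i i' => (((ℓ + 1) ^ k : ℕ) : ℝ) * (((((ℓ + 1) ^ k : ℕ)) : ℝ) ^ (d + 1)
      * (Ub F κ A₀ ℓ k M b.2.1.1 b.2.2 * dGkA0 F κ A₀ ℓ k hs a m2 b.2.2 b.2.1.2 - dGkA0 F κ A₀ ℓ k hs a m2 b.2.1.1 b.2.1.2) i i'))
    (fun b i i' => (((ℓ + 1) ^ k : ℕ) : ℝ) * (((((ℓ + 1) ^ k : ℕ)) : ℝ) ^ (d + 1)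
      * (dGkA0 F κ A₀ ℓ k hs a m2 b.2.1.1 b.2.2 * (Ub F κ A₀ ℓ k M b.2.1.2 b.2.2)ᵀ - dGkA0 F κ A₀ ℓ k hs a m2 b.2.1.1 b.2.1.2) i i'))

/-- the two-sided transport of derivative values to the base point of the first bond: `U(B̃₀(Γ_{x,y}))·D·U(B̃₀(Γ_{x′,y′}))ᵀ`
(contour-independent, `B3Eq26ConstBox.transport_eq_Ub`). [cite: Balaban1983Higgs3, (1.32) p.420] -/
def tauDA (c c' : ((Fin (d + 1) × ((↥(boxDom (Nf ℓ k M)) × ↥(boxDom (Nf ℓ k M))) × ↥(boxDom (Nf ℓ k M)))) ⊕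
      (Fin (d + 1) × ((↥(boxDom (Nf ℓ k M)) × ↥(boxDom (Nf ℓ k M))) × ↥(boxDom (Nf ℓ k M))))))
    (D : ι → ι → ℝ) : ι → ι → ℝ :=
  fun i i' => (Ub F κ A₀ ℓ k M (baseOf ℓ k M c).1 (baseOf ℓ k M c').1 * Matrix.of D
    * (Ub F κ A₀ ℓ k M (baseOf ℓ k M c).2 (baseOf ℓ k M c').2)ᵀ) i i'

/-- **‖hδG_k(Ω,Ω₂,B̃₀)h′‖_{1,α} for the constant-background instance**: r15's printed (1.32) SUM form `norm132` of `kerDA` on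
`□(v) × □(v′)` (gen 4's `sites`/`bonds`/`dirOf`/`baseOf`/`pdist`), with the covariant derivatives `derivDA` and transports `tauDA` —
the same reading of the many-variable (1.32) as the zero-field instance `B3Ineq25ZeroNest.normHGH`, now at `B̃ = B̃₀`.
[cite: Balaban1983Higgs3, (2.5) p.424] -/
def normHGHA (α : ℝ) (v v' : Fin (d + 1) → ℤ) : ℝ :=
  norm132 α (fun c c' => dirOf ℓ k M c = dirOf ℓ k M c') (fun c c' => pdist ℓ k M (baseOf ℓ k M c) (baseOf ℓ k M c'))
    (tauDA F κ A₀ ℓ k (M := M)) (sites ℓ k M v v') (bonds ℓ k M v v') (kerDA F κ A₀ ℓ k hs a m2) (derivDA F κ A₀ ℓ k hs a m2)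

end Data

/-! ## §4 The concrete carrier of B3 §2 for the constant-background nested-box instance and the unfolding of (2.5), (2.10), (2.11) -/

section Carrier

variable (F : OrthFlow ι) (κ : ℝ) (A₀ : Fin (d + 1) → ℝ) {M M0 : Fin (d + 1) → ℕ} {s : Fin (d + 1) → ℤ} [Nonempty ι]

/-- **The concrete carrier of (2.5), (2.10)–(2.12) for the MODEL INSTANCE `Ω₂ = □ = s + Π[0,M) ⊂ Ω = □₀ = Π[0,M₀)`, `B̃ = B̃₀` CONSTANT,
`N` colours** at scale `k`, admitted localizations = unit cubes of cube margin `r₀`: it EXTENDS this seat's constant-background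
carrier `B3Ineq210ConstBox.constBoxKernels` of the inner box (all its fields copied verbatim, so (2.10)/(2.11) for this carrier are
`ineq210_constBox`/`ineq211At_constBox`, cf. `ineq210_iff_constBox`) by the (2.5) data exactly as the zero-field carrier
`B3Ineq25ZeroNest.sect2DeltaZeroNest` does: `LocFn` = unit cubes of cube margin `r₀`, `distSupp = dist(□(v),□(v′))`, `distΩ₂ := r₀`
(gen 6's declared reading (i), G-B3-14), `normDeltaG α h h′ = ‖hδG_k(Ω,Ω₂,B̃₀)h′‖_{1,α}` (`normHGHA`).  NOT MODELLED: the (1.16)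
alternative (`norm116 := 0`), (2.12) (`absGavg := 0`), `eRun := pRun := 0`. [cite: Balaban1983Higgs3, (2.5) p.424] -/
def sect2DeltaConstNest (ℓ k : ℕ) (hℓ : 1 ≤ ℓ) (hs : Fits M M0 s) (a m2 : ℝ) (r₀ : ℕ) : ScaledKernels where
  Site := ↥(boxDom (Nf ℓ k M))
  Bond := ↥(boxDom (Nf ℓ k M)) × Fin (d + 1)
  Dir := Fin (d + 1)
  LocFn := {v : Fin (d + 1) → ℤ // CubeMargin M M0 s r₀ v}
  dist x x' := B4ContourShift.supNorm (x.1 - x'.1) / (((ℓ + 1) ^ k : ℕ) : ℝ)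
  dist2 x₁ x₂ x :=
    min (B4ContourShift.supNorm (x₁.1 - x.1)) (B4ContourShift.supNorm (x₂.1 - x.1)) / (((ℓ + 1) ^ k : ℕ) : ℝ)
  distBlock _ _ _ := 0
  distSupp h h' := cubeDist h.1 h'.1
  distΩ₂ := r₀
  L := (ℓ : ℝ) + 1
  η := ((((ℓ + 1) ^ k : ℕ) : ℝ))⁻¹
  d := d + 1
  eRun := 0
  pRun := 0
  one_lt_L := one_lt_L_real hℓ
  η_pos := inv_pos.2 (by positivity)
  absG j x x' := ((((ℓ + 1) ^ k : ℕ) : ℝ)) ^ (d + 1) * entrySup (blk2 (pieceA0 F κ A₀ ℓ k M j a m2) x x')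
  absDG j μ x x' :=
    if h : x.1 + Pi.single μ 1 ∈ boxDom (Nf ℓ k M) then
      ((((ℓ + 1) ^ k : ℕ) : ℝ)) ^ (d + 1)
        * (((((ℓ + 1) ^ k : ℕ) : ℝ))
          * entrySup (covDiff F κ A₀ ℓ k M (pieceA0 F κ A₀ ℓ k M j a m2) x ⟨x.1 + Pi.single μ 1, h⟩ x'))
    else 0
  holderDiff j μ x₁ x₂ x :=
    if h : x₁.1 + Pi.single μ 1 ∈ boxDom (Nf ℓ k M) ∧ x₂.1 + Pi.single μ 1 ∈ boxDom (Nf ℓ k M) then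
      ((((ℓ + 1) ^ k : ℕ) : ℝ)) ^ (d + 1)
        * (((((ℓ + 1) ^ k : ℕ) : ℝ))
          * entrySup (Ub F κ A₀ ℓ k M x₁ x₂
                * covDiff F κ A₀ ℓ k M (pieceA0 F κ A₀ ℓ k M j a m2) x₂ ⟨x₂.1 + Pi.single μ 1, h.2⟩ x
              - covDiff F κ A₀ ℓ k M (pieceA0 F κ A₀ ℓ k M j a m2) x₁ ⟨x₁.1 + Pi.single μ 1, h.1⟩ x))
    else 0
  absGavg _ _ _ := 0
  normDeltaG α h h' := normHGHA F κ A₀ ℓ k hs a m2 α h.1 h'.1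
  norm116 _ _ _ _ _ := 0

variable {F κ A₀}
variable {ℓ k : ℕ} {hℓ : 1 ≤ ℓ} {hs : Fits M M0 s} {a m2 : ℝ} {r₀ : ℕ}

/-- `(2.5)` for the carrier unfolds to the bound on `normHGHA` over pairs of admitted cubes (first conjunct) and a triviality for the
unmodelled (1.16) alternative (second conjunct). [cite: Balaban1983Higgs3, (2.5) p.424] -/
theorem ineq25_iff (α δ₀ C : ℝ) :
    (sect2DeltaConstNest F κ A₀ ℓ k hℓ hs a m2 r₀).Ineq25 α δ₀ C ↔
      (∀ h h' : {v : Fin (d + 1) → ℤ // CubeMargin M M0 s r₀ v},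
          normHGHA F κ A₀ ℓ k hs a m2 α h.1 h'.1 ≤ C * Real.exp (-(δ₀ * (r₀ : ℝ))) * Real.exp (-(δ₀ * cubeDist h.1 h'.1))) ∧
      (∀ (n n' : ℕ) (h h' : {v : Fin (d + 1) → ℤ // CubeMargin M M0 s r₀ v}),
          (0 : ℝ) ≤ C * ((0 : ℝ) * 0) ^ (n + n') * Real.exp (-(δ₀ * cubeDist h.1 h'.1))) := Iff.rfl

/-- `(2.10)` for the carrier IS `(2.10)` for `B3Ineq210ConstBox.constBoxKernels` of the inner box at `B̃₀` (fields copied), hence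
discharged by `ineq210_constBox`. [cite: Balaban1983Higgs3, (2.10) p.426] -/
theorem ineq210_iff_constBox (δ₁ C : ℝ) :
    (sect2DeltaConstNest F κ A₀ ℓ k hℓ hs a m2 r₀).Ineq210 δ₁ C ↔ (constBoxKernels F κ A₀ ℓ k hℓ M a m2).Ineq210 δ₁ C := Iff.rfl

/-- `(2.11)` (per exponent) for the carrier IS `(2.11)` for `constBoxKernels`, hence discharged by `ineq211At_constBox`.
[cite: Balaban1983Higgs3, (2.11) p.426] -/
theorem ineq211At_iff_constBox (α δ₁ C : ℝ) :
    (sect2DeltaConstNest F κ A₀ ℓ k hℓ hs a m2 r₀).Ineq211At α δ₁ C ↔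
      (constBoxKernels F κ A₀ ℓ k hℓ M a m2).Ineq211At α δ₁ C := Iff.rfl

end Carrier

/-! ## §5 Domination by the zero-field norm: every ingredient is the zero-field one times the orthogonal transporter -/

section Compare

variable {F : OrthFlow ι} {κ : ℝ} {A₀ : Fin (d + 1) → ℝ} {ℓ k : ℕ} {M M0 : Fin (d + 1) → ℕ} {s : Fin (d + 1) → ℤ}
  {hs : Fits M M0 s} {a m2 : ℝ}

/-- **values**: `F_{B̃₀}(x,x′) = F_0(x,x′)·g(x)g(x′)ᵀ` (`F_0 = B3Ineq25ZeroNest.kerD`). [cite: Balaban1983Higgs3, p.433] -/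
theorem kerDA_eq (hℓ : 1 ≤ ℓ) (hk : 1 ≤ k) (hM : ∀ i, 1 ≤ M i) (hM0 : ∀ i, 1 ≤ M0 i) (ha : 0 < a) (hm : 0 ≤ m2)
    (z : ↥(boxDom (Nf ℓ k M)) × ↥(boxDom (Nf ℓ k M))) :
    kerDA F κ A₀ ℓ k hs a m2 z
      = fun i i' => B3Ineq25ZeroNest.kerD ℓ k hs a m2 z * (gA0 F κ A₀ ℓ k M z.1 * (gA0 F κ A₀ ℓ k M z.2)ᵀ) i i' := by
  funext i i'
  rw [kerDA, dGkA0_eq hℓ hk hs hM hM0 ha hm, B3Ineq25ZeroNest.kerD, Matrix.smul_apply, smul_eq_mul, mul_assoc]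

/-- kernel: the ROW covariant difference of `δG(B̃₀)`. [folklore] -/
private theorem rowDiff_eq (hℓ : 1 ≤ ℓ) (hk : 1 ≤ k) (hM : ∀ i, 1 ≤ M i) (hM0 : ∀ i, 1 ≤ M0 i) (ha : 0 < a) (hm : 0 ≤ m2)
    (x xe x' : ↥(boxDom (Nf ℓ k M))) :
    Ub F κ A₀ ℓ k M x xe * dGkA0 F κ A₀ ℓ k hs a m2 xe x' - dGkA0 F κ A₀ ℓ k hs a m2 x x'
      = (dGk ℓ k hs a m2 xe x' - dGk ℓ k hs a m2 x x') • (gA0 F κ A₀ ℓ k M x * (gA0 F κ A₀ ℓ k M x')ᵀ) := by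
  rw [dGkA0_eq hℓ hk hs hM hM0 ha hm, dGkA0_eq hℓ hk hs hM hM0 ha hm, Ub_eq_pair, Matrix.mul_smul,
    pair_mul_pair (isGauge_gA0 F κ A₀ ℓ k M), sub_smul]

/-- kernel: the COLUMN covariant difference of `δG(B̃₀)`. [folklore] -/
private theorem colDiff_eq (hℓ : 1 ≤ ℓ) (hk : 1 ≤ k) (hM : ∀ i, 1 ≤ M i) (hM0 : ∀ i, 1 ≤ M0 i) (ha : 0 < a) (hm : 0 ≤ m2)
    (x x' xe' : ↥(boxDom (Nf ℓ k M))) :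
    dGkA0 F κ A₀ ℓ k hs a m2 x xe' * (Ub F κ A₀ ℓ k M x' xe')ᵀ - dGkA0 F κ A₀ ℓ k hs a m2 x x'
      = (dGk ℓ k hs a m2 x xe' - dGk ℓ k hs a m2 x x') • (gA0 F κ A₀ ℓ k M x * (gA0 F κ A₀ ℓ k M x')ᵀ) := by
  rw [dGkA0_eq hℓ hk hs hM hM0 ha hm, dGkA0_eq hℓ hk hs hM hM0 ha hm, Ub_eq_pair, Matrix.transpose_mul,
    Matrix.transpose_transpose, Matrix.smul_mul, pair_mul_pair (isGauge_gA0 F κ A₀ ℓ k M), sub_smul]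

/-- **covariant derivatives**: `(D F_{B̃₀})(c) = (∂F_0)(c)·g(x)g(x′)ᵀ` on every bond index `c`, `(x,x′)` its base point
(`∂F_0 = B3Ineq25ZeroNest.derivD`). [cite: Balaban1983Higgs3, p.433] -/
theorem derivDA_eq (hℓ : 1 ≤ ℓ) (hk : 1 ≤ k) (hM : ∀ i, 1 ≤ M i) (hM0 : ∀ i, 1 ≤ M0 i) (ha : 0 < a) (hm : 0 ≤ m2)
    (c : ((Fin (d + 1) × ((↥(boxDom (Nf ℓ k M)) × ↥(boxDom (Nf ℓ k M))) × ↥(boxDom (Nf ℓ k M)))) ⊕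
      (Fin (d + 1) × ((↥(boxDom (Nf ℓ k M)) × ↥(boxDom (Nf ℓ k M))) × ↥(boxDom (Nf ℓ k M)))))) :
    derivDA F κ A₀ ℓ k hs a m2 c
      = fun i i' => B3Ineq25ZeroNest.derivD ℓ k hs a m2 c
          * (gA0 F κ A₀ ℓ k M (baseOf ℓ k M c).1 * (gA0 F κ A₀ ℓ k M (baseOf ℓ k M c).2)ᵀ) i i' := by
  funext i i'
  rcases c with b | b
  · simp only [derivDA, Sum.elim_inl, rowDiff_eq hℓ hk hM hM0 ha hm, Matrix.smul_apply, smul_eq_mul, B3Ineq25ZeroNest.derivD,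
      B3Ineq25ZeroNest.kerD, baseOf]
    ring
  · simp only [derivDA, Sum.elim_inr, colDiff_eq hℓ hk hM hM0 ha hm, Matrix.smul_apply, smul_eq_mul, B3Ineq25ZeroNest.derivD,
      B3Ineq25ZeroNest.kerD, baseOf]
    ring

/-- **transported derivatives**: the two-sided transport carries `(D F_{B̃₀})(c′)` to `(∂F_0)(c′)·g(x)g(x′)ᵀ` at the base point of `c` —
the transports compensate the gauge factors exactly (p. 434). [cite: Balaban1983Higgs3, p.434] -/
theorem tauDA_derivDA_eq (hℓ : 1 ≤ ℓ) (hk : 1 ≤ k) (hM : ∀ i, 1 ≤ M i) (hM0 : ∀ i, 1 ≤ M0 i) (ha : 0 < a) (hm : 0 ≤ m2)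
    (c c' : ((Fin (d + 1) × ((↥(boxDom (Nf ℓ k M)) × ↥(boxDom (Nf ℓ k M))) × ↥(boxDom (Nf ℓ k M)))) ⊕
      (Fin (d + 1) × ((↥(boxDom (Nf ℓ k M)) × ↥(boxDom (Nf ℓ k M))) × ↥(boxDom (Nf ℓ k M)))))) :
    tauDA F κ A₀ ℓ k c c' (derivDA F κ A₀ ℓ k hs a m2 c')
      = fun i i' => B3Ineq25ZeroNest.derivD ℓ k hs a m2 c'
          * (gA0 F κ A₀ ℓ k M (baseOf ℓ k M c).1 * (gA0 F κ A₀ ℓ k M (baseOf ℓ k M c).2)ᵀ) i i' := by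
  funext i i'
  have hD : Matrix.of (derivDA F κ A₀ ℓ k hs a m2 c')
      = B3Ineq25ZeroNest.derivD ℓ k hs a m2 c'
          • (gA0 F κ A₀ ℓ k M (baseOf ℓ k M c').1 * (gA0 F κ A₀ ℓ k M (baseOf ℓ k M c').2)ᵀ) := by
    ext j j'
    rw [Matrix.of_apply, derivDA_eq hℓ hk hM hM0 ha hm, Matrix.smul_apply, smul_eq_mul]
  rw [tauDA, hD, Ub_eq_pair, Ub_eq_pair, Matrix.transpose_mul, Matrix.transpose_transpose, Matrix.mul_smul,
    pair_mul_pair (isGauge_gA0 F κ A₀ ℓ k M), Matrix.smul_mul, pair_mul_pair (isGauge_gA0 F κ A₀ ℓ k M), Matrix.smul_apply,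
    smul_eq_mul]

/-- **DOMINATION**: `‖hδG_k(Ω,Ω₂,B̃₀)h′‖_{1,α} ≤ ‖hδG_k(Ω,Ω₂,0)h′‖_{1,α}` for all cubes and every `α` (on the window).
[cite: Balaban1983Higgs3, (2.5) p.424] -/
theorem normHGHA_le (hℓ : 1 ≤ ℓ) (hk : 1 ≤ k) (hM : ∀ i, 1 ≤ M i) (hM0 : ∀ i, 1 ≤ M0 i) (ha : 0 < a) (hm : 0 ≤ m2) (α : ℝ)
    (v v' : Fin (d + 1) → ℤ) :
    normHGHA F κ A₀ ℓ k hs a m2 α v v' ≤ normHGH ℓ k hs a m2 α v v' := by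
  unfold normHGHA B3Ineq25ZeroNest.normHGH B3Sect1Statements.norm132
  refine add_le_add (add_le_add (supNorm_mono fun z => ?_) (supNorm_mono fun c => ?_)) (holderSeminorm_mono fun c c' => ?_)
  · rw [kerDA_eq hℓ hk hM hM0 ha hm, Real.norm_eq_abs]
    exact pi_norm_smul_orth_le (gA0_pair_orth F κ A₀ ℓ k M z.1 z.2) _
  · rw [derivDA_eq hℓ hk hM hM0 ha hm, Real.norm_eq_abs]
    exact pi_norm_smul_orth_le (gA0_pair_orth F κ A₀ ℓ k M _ _) _
  · rw [tauDA_derivDA_eq hℓ hk hM hM0 ha hm, derivDA_eq hℓ hk hM hM0 ha hm, Real.norm_eq_abs]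
    have : ((fun i i' => B3Ineq25ZeroNest.derivD ℓ k hs a m2 c'
          * (gA0 F κ A₀ ℓ k M (baseOf ℓ k M c).1 * (gA0 F κ A₀ ℓ k M (baseOf ℓ k M c).2)ᵀ) i i') -
        fun i i' => B3Ineq25ZeroNest.derivD ℓ k hs a m2 c
          * (gA0 F κ A₀ ℓ k M (baseOf ℓ k M c).1 * (gA0 F κ A₀ ℓ k M (baseOf ℓ k M c).2)ᵀ) i i' : ι → ι → ℝ)
        = fun i i' => (B3Ineq25ZeroNest.derivD ℓ k hs a m2 c' - B3Ineq25ZeroNest.derivD ℓ k hs a m2 c)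
          * (gA0 F κ A₀ ℓ k M (baseOf ℓ k M c).1 * (gA0 F κ A₀ ℓ k M (baseOf ℓ k M c).2)ᵀ) i i' := by
      funext i i'
      simp only [Pi.sub_apply]
      ring
    rw [this]
    exact pi_norm_smul_orth_le (gA0_pair_orth F κ A₀ ℓ k M _ _) _

end Compare

/-! ## §6 (2.5) DISCHARGED for the constant-background nested-box instance, for each Hölder exponent, uniformly in `B̃₀` -/

section Discharge

variable [Nonempty ι]

/-- **B3 (2.5) p. 424 [PDF 14], the `δG_k(Ω,Ω₂,B̃)` alternative — `ScaledKernels.Ineq25 α δ₀ C` DISCHARGED for the MODEL INSTANCE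
`Ω₂ = □ ⊂ Ω = □₀` nested boxes, `B̃ = B̃₀` CONSTANT ≠ 0, `N` colours, unit-cube localizations of cube margin `r₀ ≥ 3`.**  Verbatim:
*"‖h(an operator δG_k(Ω,Ω₂,B̃) or (1.16))h′‖_{1,α} ≤ O(e^{−δ₀dist(Ω₂,∂Ω)} or (e(L^kε)p(L^kε))^{n+n′})e^{−δ₀dist(supp h, supp h′)}, (2.5) where h, h′
are functions giving the localizations of the vertices."*  HERE: for every `0 ≤ α < 1` there are `δ₀ > 0`, `C > 0` (on `d + 1`, `L`,
the window, `α`; NOT on `B̃₀`, `κ`, the flow) such that for every scale `k ≥ 1`, window point, nested pair of boxes, `r₀ ≥ 3` and EVERY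
CONSTANT `B̃₀`: `(sect2DeltaConstNest F κ B̃₀ ℓ k hℓ hs a m² r₀).Ineq25 α δ₀ C`, i.e. `‖hδG_k(Ω,Ω₂,B̃₀)h′‖_{1,α} ≤
C·e^{−δ₀r₀}·e^{−δ₀dist(□(v),□(v′))}` for all admitted cubes, the norm being the many-variable (1.32) with COVARIANT derivatives in
both variables and two-sided TRANSPORTS.  ROUTE = the print's p. 433 gauge step: `δG_k(Ω,Ω₂,B̃₀)` is the zero-field kernel times
the orthogonal transporter (`dGkA0_eq`; the outer and inner gauges give the same transporters, `gA0_pair_emb`), every ingredient of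
the norm is dominated (`normHGHA_le`), and the zero-field instance is this seat's gen-6 `B3Ineq25ZeroNest.ineq25_zeroNest` over the six
kernel clauses of `B3DeltaGkZeroNest`.  HONEST SCOPE: (i) nested BOXES, `B̃₀` CONSTANT (non-constant `B̃` needs the p. 433
`B̃′`-expansion, not formalised), unit-cube indicator localizations of cube margin `r₀ ≥ 3`, `distΩ₂ := r₀` (gen 6's reading, G-B3-14);
(ii) the (1.16) alternative is not modelled (second conjunct trivial); (iii) block values read as functions `ι → ι → ℝ` with the sup norm
over entries (`≤ |c|` on the blocks `c·U` met here); (iv) abelian one-parameter orthogonal structure group, boxes `⊂ ηℤ^{d+1}` (not the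
torus); (v) `∀ α ∃ (δ₀, C)`, existential constants; (vi) no Literature fact minted; standard axioms. [cite: Balaban1983Higgs3, (2.5) p.424] -/
theorem ineq25_constNest (F : OrthFlow ι) (κ : ℝ) (d ℓ : ℕ) (hℓ : 1 ≤ ℓ) (amin aplus m2plus : ℝ) (ha : 0 < amin)
    {α : ℝ} (hα0 : 0 ≤ α) (hα1 : α < 1) :
    ∃ δ₀ C : ℝ, 0 < δ₀ ∧ 0 < C ∧ ∀ (k : ℕ), 1 ≤ k → ∀ (a m2 : ℝ), amin ≤ a → a ≤ aplus → 0 ≤ m2 → m2 ≤ m2plus →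
      ∀ (M M0 : Fin (d + 1) → ℕ) (s : Fin (d + 1) → ℤ) (hs : Fits M M0 s), (∀ i, 1 ≤ M i) →
      ∀ (r₀ : ℕ), 3 ≤ r₀ → ∀ (A₀ : Fin (d + 1) → ℝ),
        (sect2DeltaConstNest F κ A₀ ℓ k hℓ hs a m2 r₀).Ineq25 α δ₀ C := by
  obtain ⟨δ₀, C, hδ, hC, h⟩ := ineq25_zeroNest d ℓ hℓ amin aplus m2plus ha hα0 hα1
  refine ⟨δ₀, C, hδ, hC, fun k hk a m2 h1 h2 h3 h4 M M0 s hs hM r₀ hr A₀ => ?_⟩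
  have ha0 : 0 < a := lt_of_lt_of_le ha h1
  have hM0 : ∀ i, 1 ≤ M0 i := fun i => by
    have := hs i
    have := hM i
    omega
  have hz := (B3Ineq25ZeroNest.ineq25_iff α δ₀ C).1 (h k hk a m2 h1 h2 h3 h4 M M0 s hs hM r₀ hr)
  rw [ineq25_iff]
  refine ⟨fun hh hh' => (normHGHA_le hℓ hk hM hM0 ha0 h3 α hh.1 hh'.1).trans (hz.1 hh hh'), fun n n' hh hh' => ?_⟩
  exact hz.2 n n' hh hh'

/-- kernel: the nested pair of the witness fits (`Ω₂ = 1 + [0,7)³ ⊂ Ω = [0,9)³`). [folklore] -/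
private theorem witness_fits : Fits (fun _ : Fin (2 + 1) => 7) (fun _ => 9) (fun _ => (1 : ℤ)) :=
  fun _ => ⟨by norm_num, by norm_num⟩

/-- **witness**: (2.5) at `α = 1/2` holds with positive constants for the concrete constant-background nested-box instance
(`d + 1 = 3`, `L = 2`, `k = 1`, `Ω₂ = 1 + [0,7)³ ⊂ Ω = [0,9)³`, `N = 2` rotation flow, `κ = 1`, `B̃₀ ≡ π` — link variables `U(π) = −1`,
`B3Ineq210ConstBox.witness_link_ne_one` —, `a = 1`, `m² = 0`, `r₀ = 3`). [cite: Balaban1983Higgs3, (2.5) p.424] -/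
theorem ineq25_constNest_witness :
    ∃ δ₀ C : ℝ, 0 < δ₀ ∧ 0 < C ∧
      (sect2DeltaConstNest OrthFlow.rot 1 (fun _ : Fin (2 + 1) => Real.pi) 1 1 le_rfl witness_fits (1 : ℝ) (0 : ℝ) 3).Ineq25
        (1 / 2) δ₀ C := by
  obtain ⟨δ₀, C, hδ₀, hC, h⟩ := ineq25_constNest OrthFlow.rot 1 2 1 le_rfl 1 1 1 one_pos (α := 1 / 2) (by norm_num) (by norm_num)
  exact ⟨δ₀, C, hδ₀, hC, h 1 le_rfl 1 0 le_rfl le_rfl le_rfl zero_le_one _ _ _ witness_fits (fun _ => by norm_num) 3 le_rfl _⟩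

end Discharge

end

end Literature.MathematicalPhysics.QuantumFieldTheory.Balaban1983to89.B3Ineq25ConstNest
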